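import Mathlib.Analysis.Calculus.Deriv.Slope
import Mathlib.Topology.Order.IntermediateValue
import HarnessLib

/-!
# Buckmaster–Cao-Labora–Gómez-Serrano: the multi-barrier trapping lemma

Topic `Literature/Analysis/FluidPDE`; namespace
`Literature.Analysis.FluidPDE.BuckmasterCaolaboraGomezserrano2025.ODE`. Companion of
`CompressibleEulerImplosion.lean` (named fact `BuckmasterCaolaboraGomezserrano2025_thm11_monatomic`,
THEOREM 1.1 of T. Buckmaster, G. Cao-Labora, J. Gómez-Serrano, *Smooth imploding solutions for 3D
compressible fluids*, Forum Math. Pi 13 (2025) e6, arXiv:2208.09445).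

Brick A-trap of the discharge plan: the elementary real-analysis principle behind every
"the solution cannot exit the region through this side because the field points inwards there"
step of the paper (proof of Prop. 2.5 — the triangle `𝒯^{(H)}`; proof of Prop. 3.1 — the region
`𝒯`; the barriers of §§3–4): finitely many constraints `gᵢ(ξ) ≤ 0` along a curve are preserved
forward in time as soon as, WHILE all constraints hold, every active constraint (`gᵢ = 0`) has
strictly negative derivative (`forall_le_zero_of_deriv_neg`, by real induction). Unlike Mathlib's
single-function fencing lemmas (`image_le_of_deriv_right_lt_deriv_boundary`), the inward
condition is only required on the region itself, which is what polygonal trapping regions need.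
Theorems only, folklore. [cite: BuckmasterCaolaboraGomezserrano2025, Prop. 2.5 (proof), Prop. 3.1 (proof)]
-/

noncomputable section

open Set Filter Topology

namespace Literature.Analysis.FluidPDE

namespace BuckmasterCaolaboraGomezserrano2025

namespace ODE

/-- A function with negative derivative at `x` is, just to the right of `x`, below its value at
`x`. [folklore] -/
theorem eventually_lt_of_hasDerivAt_neg {g : ℝ → ℝ} {g' x : ℝ} (hg : HasDerivAt g g' x)
    (hneg : g' < 0) : ∀ᶠ y in 𝓝[>] x, g y < g x := by
  have ht : Tendsto (slope g x) (𝓝[≠] x) (𝓝 g') := hasDerivAt_iff_tendsto_slope.mp hg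
  have h1 : ∀ᶠ y in 𝓝[≠] x, slope g x y < 0 := (tendsto_order.1 ht).2 0 hneg
  have h2 : ∀ᶠ y in 𝓝[>] x, slope g x y < 0 :=
    h1.filter_mono (nhdsWithin_mono x fun y hy => ne_of_gt hy)
  have h3 : ∀ᶠ y in 𝓝[>] x, x < y := eventually_mem_nhdsWithin
  filter_upwards [h2, h3] with y hy hxy
  rw [slope_def_field] at hy
  have hpos : 0 < y - x := sub_pos.mpr hxy
  have := (div_neg_iff.mp hy).resolve_left (fun h => absurd h.2 (not_lt.mpr hpos.le))
  linarith [this.1]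

/-- **Multi-barrier trapping lemma.** Let `gᵢ : ℝ → ℝ`, `i` in a finite index type, be
differentiable at every point of `[a, b)` (think `gᵢ = Gᵢ ∘ c` for a solution curve `c` and the
defining functionals `Gᵢ` of a polygonal region `{Gᵢ ≤ 0}`), with `gᵢ(a) ≤ 0`. If at every
`ξ ∈ [a, b)` at which all constraints hold, every active constraint decreases strictly
(`gᵢ ξ = 0 ⇒ gᵢ′ ξ < 0`), then all constraints hold on `[a, b)`. [folklore] -/
theorem forall_le_zero_of_deriv_neg {ι : Type*} [Finite ι] {g g' : ι → ℝ → ℝ} {a b : ℝ}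
    (hg : ∀ i, ∀ ξ ∈ Ico a b, HasDerivAt (g i) (g' i ξ) ξ) (h0 : ∀ i, g i a ≤ 0)
    (hkey : ∀ ξ ∈ Ico a b, (∀ j, g j ξ ≤ 0) → ∀ i, g i ξ = 0 → g' i ξ < 0) :
    ∀ ξ ∈ Ico a b, ∀ i, g i ξ ≤ 0 := by
  intro ξ hξ
  -- real induction on `[a, ξ]`
  set s : Set ℝ := {x | ∀ i, g i x ≤ 0} with hs
  have hcont : ∀ i, ContinuousOn (g i) (Icc a ξ) := fun i x hx =>
    (hg i x ⟨hx.1, lt_of_le_of_lt hx.2 hξ.2⟩).continuousAt.continuousWithinAt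
  have hclosed : IsClosed (s ∩ Icc a ξ) := by
    have e : s ∩ Icc a ξ = Icc a ξ ∩ ⋂ i, (Icc a ξ ∩ (g i) ⁻¹' Iic 0) := by
      ext x
      simp only [hs, mem_inter_iff, mem_setOf_eq, mem_iInter, mem_preimage, mem_Iic]
      constructor
      · rintro ⟨h1, h2⟩; exact ⟨h2, fun i => ⟨h2, h1 i⟩⟩
      · rintro ⟨h1, h2⟩; exact ⟨fun i => (h2 i).2, h1⟩
    rw [e]
    exact isClosed_Icc.inter (isClosed_iInter fun i =>
      (hcont i).preimage_isClosed_of_isClosed isClosed_Icc isClosed_Iic)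
  have ha : a ∈ s := h0
  have hgt : ∀ x ∈ s ∩ Ico a ξ, s ∈ 𝓝[>] x := by
    rintro x ⟨hx, hxI⟩
    have hxb : x ∈ Ico a b := ⟨hxI.1, hxI.2.trans hξ.2⟩
    have hev : ∀ i, ∀ᶠ y in 𝓝[>] x, g i y ≤ 0 := by
      intro i
      rcases lt_or_eq_of_le (hx i) with hlt | heq
      · have hc : ContinuousAt (g i) x := (hg i x hxb).continuousAt
        have : ∀ᶠ y in 𝓝 x, g i y < 0 := hc.eventually (gt_mem_nhds hlt)
        exact (this.filter_mono nhdsWithin_le_nhds).mono fun y hy => hy.le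
      · have hd := eventually_lt_of_hasDerivAt_neg (hg i x hxb) (hkey x hxb hx i heq)
        exact hd.mono fun y hy => by rw [heq] at hy; exact hy.le
    have hall : ∀ᶠ y in 𝓝[>] x, ∀ i, g i y ≤ 0 := eventually_all.mpr hev
    exact hall
  have hsub := hclosed.Icc_subset_of_forall_mem_nhdsWithin ha hgt
  exact hsub ⟨hξ.1, le_rfl⟩

end ODE

end BuckmasterCaolaboraGomezserrano2025

end Literature.Analysis.FluidPDE
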